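import Summits.CriticalPhenomena.PercolationContinuityZ3.Theorems.PercNearOneGluingNoHeavyLowerTailCILBlobsNoLightPair
import Summits.CriticalPhenomena.PercolationContinuityZ3.Theorems.PercNearOneGluingNoHeavyLowerTailTwoCutMasterSet
import HarnessLib

/-!
# `NoHeavyLowerTail` (stmt-CriticalPhenomena-4575) — the cumulative isolation lemma on blob structures, III:
# one jointly-light pair of blobs, all other blobs individually heavy (any number of blobs)

Support file (depth prover nh-dp-blobmono; `--supports stmt-CriticalPhenomena-4575`).  No definitions, no
named facts, no sorries.  Notation as in parts I–II (`…CILBlobsNoLightPair`, `…CILFourBlobs`).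

`cumulativeIsolation_blobs_lightPair_heavyRest` — blob structure `cls : Fin n → Fin b` (ANY `b`), level `j`,
two labels `p ≠ q` with nonempty blobs of joint mass `m_p + m_q ≤ j`, and every other nonempty relay blob
individually heavy (`m_ℓ > j`).  Then the light relay sets are exactly the nonempty subsets of blobs `p, q`, the
minority event `{1 ≤ N ≤ j}` is (a.s.) "`o` holds `a` or `b` and misses every other relay", and the HEAVY-SET
EXIT BOUND `Theorems.lonelyOrPairSet_le_max` (set-sink tripod exchange, van den Berg–Häggström–Kahn Thm 1.5)
with the sink `T = {relays outside blobs p, q}` gives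
`μ{1 ≤ N ≤ j} ≤ max(μ{a ↮ T}, μ{b ↮ T}) ≤ max(μ{|π(a)| ≤ j}, μ{|π(b)| ≤ j})`.

This is the first five-blob threshold family beyond parts I–II (masses `(1,1,3,3)`, `j = 2`: two heavy blobs
that need not be joined to each other, so it is not a four-blob statement on a quotient), and it holds for
any number of heavy blobs.
-/

noncomputable section

namespace Summit.CriticalPhenomena.PercolationContinuityZ3.Theorems

open MeasureTheory Set Literature.Probability.LatticeModels Literature.Probability.Percolation
open scoped Classical BigOperators

variable {n : ℕ}

open CILBlobs in
/-- **CIL for a jointly-light pair of blobs with all other blobs heavy (any number of blobs).**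
[cite: VandenbergHaggstromKahn2005, Thm. 1.5 — via lonelyOrPairSet_le_max] -/
theorem cumulativeIsolation_blobs_lightPair_heavyRest {b : ℕ} (w : Sym2 (Fin n) → unitInterval)
    (A : Finset (Fin n)) (o : Fin n) (j : ℕ) (cls : Fin n → Fin b)
    (hcls : ∀ u ∈ insert o A, ∀ v ∈ insert o A, cls u = cls v →
      (prodBernoulli w).real (openConn u v)ᶜ = 0)
    (p q : Fin b) {a b' : Fin n} (ha : a ∈ A) (hca : cls a = p) (hb : b' ∈ A) (hcb : cls b' = q)
    (hpq : (A.filter fun x => cls x = p).card + (A.filter fun x => cls x = q).card ≤ j)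
    (hheavy : ∀ x ∈ A, cls x ≠ p → cls x ≠ q → j < (A.filter fun y => cls y = cls x).card) :
    ∃ a ∈ A, (prodBernoulli w).real {ω : BondConfig (Fin n) |
        1 ≤ (A.filter fun y => ω ∈ openConn o y).card ∧
          (A.filter fun y => ω ∈ openConn o y).card ≤ j} ≤
      (prodBernoulli w).real {ω : BondConfig (Fin n) |
        (A.filter fun y => ω ∈ openConn a y).card ≤ j} := by
  set μ := prodBernoulli w with hμ
  set L := {ω : BondConfig (Fin n) | 1 ≤ (A.filter fun y => ω ∈ openConn o y).card ∧
    (A.filter fun y => ω ∈ openConn o y).card ≤ j} with hL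
  -- the sink: every relay outside blobs `p, q`
  set T : Finset (Fin n) := A.filter fun x => cls x ≠ p ∧ cls x ≠ q with hT
  -- step 1: on the good set the minority event is the heavy-set exit event
  have hsub : L ∩ {ω : BondConfig (Fin n) | ∀ u ∈ insert o A, ∀ v ∈ insert o A,
        cls u = cls v → (openGraph ω).Reachable u v} ⊆
      {ω | ∀ t ∈ T, ω ∉ (openConn o t : Set (BondConfig (Fin n)))} ∩ (openConn o a ∪ openConn o b') := by
    rintro ω ⟨⟨h1, hj⟩, hωG⟩
    refine ⟨fun t ht hot => ?_, ?_⟩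
    · obtain ⟨htA, htp, htq⟩ := Finset.mem_filter.1 ht
      have hot' : (openGraph ω).Reachable o t := hot
      have hcount := blobs_count_ge_one A o cls ω hωG htA hot'
      have hlt := hheavy t htA htp htq
      omega
    · obtain ⟨a₀, ha₀⟩ := Finset.card_pos.1 (by omega : 0 < (A.filter fun y => ω ∈ openConn o y).card)
      obtain ⟨ha₀A, hoa₀⟩ := Finset.mem_filter.1 ha₀
      have hoa₀' : (openGraph ω).Reachable o a₀ := hoa₀
      by_cases hp : cls a₀ = p
      · exact Or.inl (hoa₀'.trans (hωG a₀ (Finset.mem_insert_of_mem ha₀A) a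
          (Finset.mem_insert_of_mem ha) (hp.trans hca.symm)))
      by_cases hq : cls a₀ = q
      · exact Or.inr (hoa₀'.trans (hωG a₀ (Finset.mem_insert_of_mem ha₀A) b'
          (Finset.mem_insert_of_mem hb) (hq.trans hcb.symm)))
      · have hcount := blobs_count_ge_one A o cls ω hωG ha₀A hoa₀'
        have hlt := hheavy a₀ ha₀A hp hq
        omega
  have hLle := oneCut_of_blobs_trap w A o _ cls hcls L _ hsub le_rfl
  -- step 2: a relay of blob `p` or `q` cut from `T` sees at most the light pair
  have hcut : ∀ {x : Fin n}, x ∈ A → (cls x = p ∨ cls x = q) →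
      μ.real {ω | ∀ t ∈ T, ω ∉ (openConn x t : Set (BondConfig (Fin n)))} ≤
        μ.real {ω : BondConfig (Fin n) | (A.filter fun y => ω ∈ openConn x y).card ≤ j} := by
    intro x hx hcx
    refine measureReal_mono fun ω hω => ?_
    show (A.filter fun y => ω ∈ openConn x y).card ≤ j
    have hsubpq : (A.filter fun y => ω ∈ openConn x y) ⊆
        (A.filter fun y => cls y = p) ∪ (A.filter fun y => cls y = q) := by
      intro y hy
      obtain ⟨hyA, hxy⟩ := Finset.mem_filter.1 hy
      by_cases hyp : cls y = p
      · exact Finset.mem_union_left _ (Finset.mem_filter.2 ⟨hyA, hyp⟩)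
      by_cases hyq : cls y = q
      · exact Finset.mem_union_right _ (Finset.mem_filter.2 ⟨hyA, hyq⟩)
      · exact absurd hxy (hω y (Finset.mem_filter.2 ⟨hyA, hyp, hyq⟩))
    exact le_trans (Finset.card_le_card hsubpq) (le_trans (Finset.card_union_le _ _) hpq)
  have hD : μ.real L ≤ max (μ.real {ω : BondConfig (Fin n) | (A.filter fun y => ω ∈ openConn a y).card ≤ j})
      (μ.real {ω : BondConfig (Fin n) | (A.filter fun y => ω ∈ openConn b' y).card ≤ j}) :=
    calc μ.real L ≤ μ.real ({ω | ∀ t ∈ T, ω ∉ (openConn o t : Set (BondConfig (Fin n)))} ∩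
          (openConn o a ∪ openConn o b')) := hLle
      _ ≤ max (μ.real {ω | ∀ t ∈ T, ω ∉ (openConn a t : Set (BondConfig (Fin n)))})
          (μ.real {ω | ∀ t ∈ T, ω ∉ (openConn b' t : Set (BondConfig (Fin n)))}) :=
        lonelyOrPairSet_le_max w o a b' T
      _ ≤ _ := max_le_max (hcut ha (Or.inl hca)) (hcut hb (Or.inr hcb))
  rcases le_total
      (μ.real {ω : BondConfig (Fin n) | (A.filter fun y => ω ∈ openConn a y).card ≤ j})
      (μ.real {ω : BondConfig (Fin n) | (A.filter fun y => ω ∈ openConn b' y).card ≤ j}) with h | h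
  · exact ⟨b', hb, hD.trans (by rw [max_eq_right h])⟩
  · exact ⟨a, ha, hD.trans (by rw [max_eq_left h])⟩

end Summit.CriticalPhenomena.PercolationContinuityZ3.Theorems

end
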